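import Literature.Probability.Percolation.ArmSeparationSlotEvents
import HarnessLib

/-!
# Slot events: the corridors have probability bounded below

Topic: Probability / Percolation; family `crit-perc`. A brick of the discharge of
`Literature.Probability.Percolation.Nolin2008_twoArm_separation` (Nolin 2008, Thm. 11
[arXiv 0711.4948: Thm. 10]; `ArmSeparation.lean`), landing step of the internal extremities
(Nolin 2008, Prop. 12 [arXiv Prop. 11]: "`P(Ã⁺), P(Ã⁻) ≥ C(η)` by RSW"). The corridor event
`corrEvent` (`ArmSeparationSlotDefs.lean`) is the intersection of five increasing local events —
beacon (a frame), spoke, all tubes of an arc, approach tube, target free space — so by Harris'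
inequality and RSW its probability is at least `c_F · c_ρ ^ (len + 3)` where `c_F` is the frame
constant of `exists_pos_le_real_triFrameAt`, `c_ρ` the box-crossing constant of
`tri_rsw_half_holds` at an aspect ratio `ρ` dominating those of the spoke (`(L + k/4) / (2ε)`), of
the ring tubes (`4`), of the approach tube and of the target box, and `len` the number of tubes of
the arc (`real_corrEvent_ge`). The same bound holds for the reflected corridor of the closed arm
(`P_{1/2}` is `negFlip`-invariant).

## References

* P. Nolin, *Near-critical percolation in two dimensions*, Electron. J. Probab. 13 (2008), §4.3
  Prop. 12 (proof) [arXiv 0711.4948: Prop. 11]. [Nolin2008]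
* G. Grimmett, *Percolation*, 2nd ed. (1999), §11.7 (RSW), Thm. 2.4 (Harris–FKG). [GrimmettPercolation1999]
-/

noncomputable section

open Set MeasureTheory

namespace Literature.Probability.Percolation

open LatticeModels HalfAnnulus Tube

/-- The approach tube event is the crossing event of a tube. [folklore] -/
theorem tgtH_eq_event (n : ℕ) (t : ℤ) (W : ℕ) : tgtH n t W = (⟨(n : ℤ) - (n / 8 : ℕ) + 1, t, W, n / 64, true⟩ : Tube).event := rfl

/-- The target free space event is the crossing event of a tube. [folklore] -/
theorem tgtV_eq_event (n : ℕ) (t : ℤ) :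
    tgtV n t = (⟨(n : ℤ) - (n / 8 : ℕ) + 1, t - (n / 64 : ℕ), n / 8 - 2, 2 * (n / 64), false⟩ : Tube).event := rfl

/-- Aspect ratios are monotone in the bound. [folklore] -/
theorem Tube.AspectLE.mono {T : Tube} {ρ ρ' : ℕ} (h : T.AspectLE ρ) (hρ : ρ ≤ ρ') : T.AspectLE ρ' := by
  unfold Tube.AspectLE at h ⊢
  cases hh : T.horiz
  · rw [hh] at h; simp only [cond_false] at h ⊢; exact ⟨h.1.trans (Nat.mul_le_mul_right _ hρ), h.2⟩
  · rw [hh] at h; simp only [cond_true] at h ⊢; exact ⟨h.1.trans (Nat.mul_le_mul_right _ hρ), h.2⟩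

/-- **The corridor event has probability at least `c_F c_ρ^(len + 3)`.** Hypotheses: the frame
constant `c_F` (`exists_pos_le_real_triFrameAt`), the RSW constant `c_ρ` at aspect ratio `ρ ≥ 4`
(`0 ≤ c_ρ`), `2 ≤ k`, `1 ≤ ε` and `L + k/4 ≤ 2ρε` (spoke), `1 ≤ e` and `s + 2e ≤ 8e` (ring tubes), `1 ≤ n/64` and `W ≤ ρ (n/64)` (approach tube),
`2 (n/64) ≤ n/8 - 2` and `1 ≤ n/8 - 2` (target box), and `len` bounds the length of the arc. [cite: Nolin2008, §4.3 Prop. 12 (proof) (arXiv 0711.4948: Prop. 11)] -/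
theorem real_corrEvent_ge {cF c : ℝ} {ρ : ℕ} (hF : ∀ (z : Site 2) (k : ℕ), 1 ≤ k → cF ≤ (triSitePercolation half).real (triFrameAt z k))
    (hrsw : ∀ q : ℕ, 1 ≤ ⌊(ρ : ℝ) * q⌋₊ → c ≤ triLRCrossingProb half ⌊(ρ : ℝ) * q⌋₊ q) (hρ : 4 ≤ ρ) (hc : 0 ≤ c)
    {i m n k : ℕ} (hk : 2 ≤ k) {T₀ : ℤ} {w L ε r e s a len : ℕ} {t : ℤ} {W : ℕ}
    (hε : 1 ≤ ε) (hsp : L + k / 4 ≤ ρ * (2 * ε)) (he : 1 ≤ e) (hse : s + 2 * e ≤ 4 * (2 * e))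
    (hn : 1 ≤ n / 64) (hW : W ≤ ρ * (n / 64)) (hV : 2 * (n / 64) ≤ n / 8 - 2) (hV' : 1 ≤ n / 8 - 2)
    (hlen : (arc (thinRing r e s) a len).length ≤ len) :
    cF * c ^ (len + 3) ≤ (triSitePercolation half).real (corrEvent i m n k T₀ w L ε r e s a len t W) := by
  have hρ1 : 1 ≤ ρ := le_trans (by norm_num) hρ
  have hc1 : c ≤ 1 := by
    have h := hrsw 1 (by
      rw [Nat.cast_one, mul_one, Nat.floor_natCast]; exact hρ1)
    exact h.trans measureReal_le_one
  -- the five events, their supports and monotonicity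
  set E1 := bcnEvent i m k T₀ w with hE1
  set E2 := spokeEvent i m k T₀ w L ε with hE2
  set E3 := eventAll (arc (thinRing r e s) a len) with hE3
  set E4 := tgtH n t W with hE4
  set E5 := tgtV n t with hE5
  have d1 : DeterminedBy E1 ↑((triSqAnnulusFinset (bcnCentre m k T₀ w) (k / 2) (2 * (k / 2))).image (frameIso i)) := by
    rw [Finset.coe_image]; exact determinedBy_preimage_frameConfig i (determinedBy_triFrameAt _ _)
  have d2 : DeterminedBy E2 ↑((spokeTube m k T₀ w L ε).sites.image (frameIso i)) := by
    rw [Finset.coe_image, coe_sites]; exact determinedBy_spokeEvent i m k T₀ w L ε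
  have d3 : DeterminedBy E3 ↑(sitesAll (arc (thinRing r e s) a len)) := determinedBy_eventAll _
  have d4 : DeterminedBy E4 ↑(triStripFinset ((n : ℤ) - (n / 8 : ℕ) + 1) t W (n / 64)) := determinedBy_triHCross _ _ _ _
  have d5 : DeterminedBy E5 ↑(triStripFinset ((n : ℤ) - (n / 8 : ℕ) + 1) (t - (n / 64 : ℕ)) (n / 8 - 2) (2 * (n / 64))) :=
    determinedBy_triVCross _ _ _ _
  have u1 : IsUpperSet E1 := isUpperSet_bcnEvent i m k T₀ w
  have u2 : IsUpperSet E2 := isUpperSet_spokeEvent i m k T₀ w L ε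
  have u3 : IsUpperSet E3 := isUpperSet_eventAll _
  have u4 : IsUpperSet E4 := isUpperSet_triHCross _ _ _ _
  have u5 : IsUpperSet E5 := isUpperSet_triVCross _ _ _ _
  -- the five probabilities
  have p1 : cF ≤ (triSitePercolation half).real E1 := by
    rw [hE1, bcnEvent, show {χ | frameConfig i χ ∈ triFrameAt (bcnCentre m k T₀ w) (k / 2)} =
      frameConfig i ⁻¹' triFrameAt (bcnCentre m k T₀ w) (k / 2) from rfl, real_preimage_frameConfig]
    exact hF _ _ (by omega)
  have p2 : c ≤ (triSitePercolation half).real E2 := by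
    rw [hE2, real_spokeEvent]
    refine Tube.le_real_event _ hrsw hρ1 ?_
    simp only [Tube.AspectLE, spokeTube, cond_true]
    exact ⟨hsp, by omega⟩
  have p3 : c ^ len ≤ (triSitePercolation half).real E3 := by
    refine le_trans (pow_le_pow_of_le_one hc hc1 hlen) ?_
    refine Tube.pow_le_real_eventAll hrsw hρ1 hc _ fun T hT => ?_
    exact (aspectLE_of_mem_thinRing he hse (mem_of_mem_arc hT)).mono hρ
  have p4 : c ≤ (triSitePercolation half).real E4 := by
    rw [hE4, tgtH_eq_event]
    refine Tube.le_real_event _ hrsw hρ1 ?_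
    simp only [Tube.AspectLE, cond_true]
    exact ⟨hW, hn⟩
  have p5 : c ≤ (triSitePercolation half).real E5 := by
    rw [hE5, tgtV_eq_event]
    refine Tube.le_real_event _ hrsw hρ1 ?_
    simp only [Tube.AspectLE, cond_false]
    exact ⟨hV.trans (Nat.le_mul_of_pos_left _ hρ1), hV'⟩
  -- Harris, four times
  have h12 := sitePercolation_harris' half d1 d2 u1 u2
  have d12 : DeterminedBy (E1 ∩ E2) ↑((triSqAnnulusFinset (bcnCentre m k T₀ w) (k / 2) (2 * (k / 2))).image (frameIso i) ∪
      (spokeTube m k T₀ w L ε).sites.image (frameIso i)) := by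
    rw [Finset.coe_union]; exact (d1.mono subset_union_left).inter (d2.mono subset_union_right)
  have h123 := sitePercolation_harris' half d12 d3 (u1.inter u2) u3
  have d123 : DeterminedBy (E1 ∩ E2 ∩ E3) ↑(((triSqAnnulusFinset (bcnCentre m k T₀ w) (k / 2) (2 * (k / 2))).image (frameIso i) ∪
      (spokeTube m k T₀ w L ε).sites.image (frameIso i)) ∪ sitesAll (arc (thinRing r e s) a len)) := by
    rw [Finset.coe_union]; exact (d12.mono subset_union_left).inter (d3.mono subset_union_right)
  have h1234 := sitePercolation_harris' half d123 d4 ((u1.inter u2).inter u3) u4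
  have d1234 : DeterminedBy (E1 ∩ E2 ∩ E3 ∩ E4)
      ↑((((triSqAnnulusFinset (bcnCentre m k T₀ w) (k / 2) (2 * (k / 2))).image (frameIso i) ∪
      (spokeTube m k T₀ w L ε).sites.image (frameIso i)) ∪ sitesAll (arc (thinRing r e s) a len)) ∪
      triStripFinset ((n : ℤ) - (n / 8 : ℕ) + 1) t W (n / 64)) := by
    rw [Finset.coe_union]; exact (d123.mono subset_union_left).inter (d4.mono subset_union_right)
  have h12345 := sitePercolation_harris' half d1234 d5 (((u1.inter u2).inter u3).inter u4) u5
  have hnn : ∀ A : Set (SiteConfig (Site 2)), 0 ≤ (sitePercolation (Site 2) half).real A := fun A => measureReal_nonneg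
  unfold triSitePercolation at p1 p2 p3 p4 p5 ⊢
  unfold corrEvent
  rw [← hE1, ← hE2, ← hE3, ← hE4, ← hE5]
  calc cF * c ^ (len + 3) = cF * c * c ^ len * c * c := by ring
    _ ≤ (sitePercolation (Site 2) half).real E1 * (sitePercolation (Site 2) half).real E2 *
        (sitePercolation (Site 2) half).real E3 * (sitePercolation (Site 2) half).real E4 * (sitePercolation (Site 2) half).real E5 := by
      gcongr
    _ ≤ (sitePercolation (Site 2) half).real (E1 ∩ E2 ∩ E3 ∩ E4 ∩ E5) := by
      calc _ ≤ (sitePercolation (Site 2) half).real (E1 ∩ E2) * (sitePercolation (Site 2) half).real E3 *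
            (sitePercolation (Site 2) half).real E4 * (sitePercolation (Site 2) half).real E5 := by gcongr
        _ ≤ (sitePercolation (Site 2) half).real (E1 ∩ E2 ∩ E3) * (sitePercolation (Site 2) half).real E4 *
            (sitePercolation (Site 2) half).real E5 := by gcongr
        _ ≤ (sitePercolation (Site 2) half).real (E1 ∩ E2 ∩ E3 ∩ E4) * (sitePercolation (Site 2) half).real E5 := by gcongr
        _ ≤ _ := h12345

namespace Slot

/-- **The corridor of the closed arm has the same probability bound** (`P_{1/2}` is `negFlip`-invariant). [folklore] -/
theorem real_whiteCorr_eq (P : LParams) (σ : Slot) :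
    (triSitePercolation half).real (σ.whiteCorr P) = (triSitePercolation half).real
      (corrEvent σ.ic' P.m P.n (σ.kc P) (σ.Tc P) P.w P.LW P.ε P.rW P.e P.s (σ.aW P) (σ.lenW P) (σ.tgc P) P.WW) :=
  triSitePercolation_real_preimage_negFlip _

end Slot

end Literature.Probability.Percolation
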